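import Summits.BirchSwinnertonDyer.BirchSwinnertonDyer.Theorems.ErratumRoadFiveIMCDivRoadFFFittingFrameBOfThm23
import Summits.BirchSwinnertonDyer.BirchSwinnertonDyer.Theorems.ErratumRoadFiveSelfDualMemberCongruenceErratum
import Summits.BirchSwinnertonDyer.BirchSwinnertonDyer.Theorems.ErratumRoadFiveSurjIrrK
import Summits.BirchSwinnertonDyer.BirchSwinnertonDyer.Theorems.ErratumRoadFiveIMCDivRoadFFSigmaDataBOfFacts
import Summits.BirchSwinnertonDyer.BirchSwinnertonDyer.Theorems.ErratumRoadFiveIMCDivAtomsBRamFree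
import Literature.NumberTheory.EllipticCurves.Castella2018.ErratumThm23UpperDivisibilitySelfDualIrrK
import Literature.NumberTheory.EllipticCurves.Castella2018.ErratumHidaMembersFramesWeightRamFree
import Literature.NumberTheory.EllipticCurves.Rank1Residual.X9NoEntry
import HarnessLib

/-!
# Route `ErratumRoadFive` (K2, `p ≥ 5`), crux `Rest3NoWitnessBranchAtFive` (item stmt-BirchSwinnertonDyer-19703) — ROAD FF on
# the «RAM-FREE» erratum data: Σ-data + the Fitting-level congruence frame from F4♯‡ + F3♯‡ ⟹ the ram-free re-oriented core shape

Cell `bsd-stepL`, seat `bsd-stepL-imc-p1` (prover g32, 2026-08-29); `--supports stmt-BirchSwinnertonDyer-19703 --as helper`;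
Theses-free. Step K4 (Road FF half) of `HOME/imc-p1/g26/RAMFREE-REKEY-PROPOSAL.md`, executed as a PARTIAL RESULT on the open
crux 19703 (its NEW_A rows); the route, its items, statements and registry are untouched (planner RULING 86 (c)).

## What this file proves and why it exists

The companion file `ErratumRoadFiveKernelFromPrintBRamFree` reduces crux 19703 to the shrunken residual «19703‡» modulo PRINT
and the ram-free re-oriented CORE shape `∀ W p, P2.IMCDivIntCoreFrameAtErratumDataBRamFree W p` (file
`ErratumRoadFiveIMCDivAtomsBRamFree`). This file DELIVERS that shape by Road FF, exactly as imc-p1 g30's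
`…FittingFrameBOfThm23SelfDualIrrK` (p687733) and g12's `…SigmaDataBOfFacts` deliver the landed shape, from:

* `h23 : Castella2018.erratumThm23_charIdeal_sigma_le_of_isTorsion_selfDual_irrK_OPEN` — F4♯‡ (imc-p1 g26, p675866), the
  erratum's Thm. 2.3 «⊂» (2.5) on the self-dual `A_g` with hypotheses (i) «`ρ̄_g|_{G_K}` irreducible» and (iii) «some `q ∥ M`
  non-split in `K`» AS PRINTED ([FW21 Thm. 4.41] bullets 1–3) — OPEN; on the tree it is the conclusion of crux 23253's line
  from the one stub S1‡ (g31's `ErratumChainSelfDualIrrK.…_of_twoVarCoreIrrK_of_thm326`, p690124);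
* `hL : Castella2018.erratum_exists_frames_members_sigma_congruence_wt_ramFree` — F3♯‡ (this seat, p694306): the PUBLISHED
  member package (Hida members in the weight progression `2(p−1)p^{m−1} ∣ k_m − 2`, frames, Steinberg signs, congruence (c))
  WITHOUT the (iii)-witness binders and without the footnote-1 conjuncts — Hida theory does not use the witness;
* `hloc` (K2 item 20495 `JSWSigmaLocalCharIdeal`, PROVED), `h323` (Shapiro, SU14 Prop. 3.2.3, PROVED on the tree), GZK,
  modularity and the two Poitou–Tate facts — the Σ-data (the landed supplier read `ErratumHypotheses W p` only for `5 ≤ p`,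
  `Mult W p`; its `hmq`/`hvq` were already idle: `P2.RoadFF.isTorsion_XAc_empty_of_facts_of_isErratumField` marks them `_`).

How F4♯‡'s printed hypotheses are met at a ram-free datum and a member `g_m`: (i) from the BINDER `Surj W p` through g27's
bridge `SurjIrrK.isSimpleOrder_subrepresentation_residualRep_comp_of_surj` (on the NEW_A rows `E[p]` is ramified at SOME
multiplicative prime, not necessarily the datum's `q`); (iii) by the datum's `q` (`q ∥ M`, `q ∣ d_K`). Everything else (`Σ`,
degree-one completion at `𝔭bar`, SU14 L.3.1.9, the member congruences `e_m` — where `E(ℚ_p)[p] = 0` is consumed —, (2.5)_m,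
(c), the two-slot Fitting frame through `𝓞_{ℂ_p}⟦T⟧`) is g30's proof symbol for symbol.

* §1 Σ-data at an erratum field, ANY X-slot, from `5 ≤ p`, `Mult W p`; §2 the two-slot Fitting congruence frame at a ram-free
  datum from F4♯‡ + F3♯‡; §3 the ram-free core shape of EVERY pair (imc24b's datum glue `P2.exists_intCoreFrame_of_roadFF_fitting_twoSlot`).

HONEST FRAMING: theorems only (no definition, no named fact minted here, no `sorry`); CONDITIONAL on the named facts, one of
which (F4♯‡, arXiv:2107.13726 Thm. 4.41) is OPEN; nothing booked; BSD is proved for no pair; no census number moves (T7).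
References: [Castella2018Erratum] §2, Thm. 1.1 (iii), Thm. 2.3, (2.3)–(2.5), (a)(b)(c), Lemma 2.1, footnote 1, proof of Thm. 1.1
(pp. 1–4); [FouquetWan2021] Thm. 4.41 (PREPRINT); [Serre1972] Prop. 15; [Skinner2016PacificMC] §2.6, §3.1; [SkinnerUrban2014]
Prop. 3.2.3, L. 3.1.9; [Castella2020JIMJ] Thm. 2.11; [Castella2018] Thm. 2.3, Prop. 2.5, Thm. 3.1, (3.1), (4.1); [JetchevSkinnerWan2017]
Thm. 3.3.1, §5.1, proof of Thm. 6.1.6.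
-/

set_option autoImplicit false

noncomputable section

open scoped TensorProduct Classical

open CategoryTheory PowerSeries NumberField IsDedekindDomain Field WeierstrassCurve
open Literature.NumberTheory.GaloisRepresentations Literature.NumberTheory.EllipticCurves
  Literature.NumberTheory.EllipticCurves.BigGaloisRep Literature.NumberTheory.EllipticCurves.GreenbergSelmer
  Literature.NumberTheory.EllipticCurves.Skinner2016 Literature.NumberTheory.EllipticCurves.Rank1Residual
  Literature.NumberTheory.EllipticCurves.Rank1Residual.Typed Literature.NumberTheory.EllipticCurves.ModularForms
  Literature.NumberTheory.EllipticCurves.Castella2018 Literature.NumberTheory.EllipticCurves.JetchevSkinnerWan2017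
  Literature.NumberTheory.GaloisCohomology
open Summit.BirchSwinnertonDyer.Rank1Residual.X11b.Halves Summit.BirchSwinnertonDyer.Rank1Residual.X11b.AcSelmer
open Summit.BirchSwinnertonDyer.Rank1Residual

namespace Summit.BirchSwinnertonDyer.Rank1Residual.X11b

open RoadFFMember Summit.BirchSwinnertonDyer.BirchSwinnertonDyer.Theorems

/-! ### §1 Σ-data at an erratum field from `5 ≤ p`, `Mult W p` (no `ErratumHypotheses`, no `hvq`) -/

section SigmaData

variable (W : WeierstrassCurve ℚ) [W.IsElliptic] [W.IsGloballyMinimal] (p : ℕ) [Fact p.Prime]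
  {K : Type} [Field K] [NumberField K]

/-- **`Σ`-data at an erratum field, ANY X-slot `v ∋ p`, from the LOCAL fact + Shapiro + the kernel control theorem — RAM-FREE
binders.** `P2.RoadFF.sigmaDataAt_of_sigmaLocal_of_prop323_of_facts_of_isErratumField` VERBATIM with `hE : ErratumHypotheses W p`
replaced by `5 ≤ p`, `Mult W p` (all it read) and the idle `hvq` dropped: the torsion of `X^∅_ac` by
`P2.RoadFF.controlOnTreeAt_of_facts_of_isErratumField` (GZK + modularity + Poitou–Tate), the no-defect binder by
`noTamagawaDefect_sigmaPlaces_of_splitMult_imp_degree_one` (split multiplicative primes of `N` have degree-one places on an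
erratum field for a NON-SPLIT `q`), the Euler data and `P_Σ ≠ 0` as there. CONDITIONAL on `hloc`, `h323`, `hGZK`, `hnf`, `hPT`,
`hPT2`. [cite: JetchevSkinnerWan2017, proof of Thm. 6.1.6 (arXiv:1512.06894 tex p0026 L82–96) and Thm. 3.3.1 with §3.5 (3.5.c)]
[cite: SkinnerUrban2014, Prop. 3.2.3 (Shapiro)] [cite: Castella2018, Thm. 2.3 (2.7) and Prop. 2.5 (arXiv:1704.06608 p. 7)] -/
theorem P2.RoadFF.sigmaDataAt_of_sigmaLocal_of_prop323_of_facts_of_isErratumField_ramFree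
    (hloc : sigmaLocal_charIdeal_eulerFactor_mem_of_noTamagawaDefect)
    (h323 : SkinnerUrban2014.prop323_XAc_equiv_XBigDecomp)
    (hGZK : rank_eq_analyticRank_of_analyticRank_le_one) (hnf : exists_isNewformOf)
    (hPT : ∀ (K : Type) [Field K] [NumberField K], poitouTate_selmerStructure_duality K)
    (hPT2 : ∀ (K : Type) [Field K] [NumberField K], poitouTate_sha_tateDual K)
    (hp5 : 5 ≤ p) (hmult : Mult W p) (hr : W.analyticRank = 1) {q : ℕ} [Fact q.Prime] (hqp : q ≠ p)
    (hmq : Mult W q) (hnsq : ¬ W.HasSplitMultiplicativeReductionAtPrime q) (hK : IsErratumField W K q)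
    (P : (W.baseChange K).toAffine.Point) (hP : ¬ IsOfFinAddOrder P)
    (κ : ZpExtension K p) (hκ : κ.IsAnticyclotomic) (γ : Field.absoluteGaloisGroup K)
    [Fact (κ.IsTopGenerator γ)] (v : HeightOneSpectrum (𝓞 K)) (hv : ((p : ℕ) : 𝓞 K) ∈ v.asIdeal) :
    P2.RoadFF.SigmaDataAt W p κ v γ (↑(W.sigmaPlacesFinset p K) : Set (HeightOneSpectrum (𝓞 K)))
      (W.sigmaEulerElement p K κ) := by
  have hp3 : 3 < p := lt_of_lt_of_le (by norm_num) hp5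
  have hp2 : p ≠ 2 := by omega
  have hsp : SplitsIn K p := hK.splitsIn_of_mult hmult (Ne.symm hqp)
  have hHp : SatisfiesHeegnerHypothesis p K := satisfiesHeegnerHypothesis_of_splitsIn Fact.out hsp
  obtain ⟨n, hn, -⟩ := P2.RoadFF.controlOnTreeAt_of_facts_of_isErratumField W p hGZK hnf hPT hPT2 hp2 hmult hr hqp
    hK P hP κ hκ γ v hv
  have hT₀ : Module.IsTorsion (IwasawaAlgebra p) (XAc (W.baseChange K) p κ v ∅ γ) := hn.1
  have hB := W.noTamagawaDefect_sigmaPlaces_of_splitMult_imp_degree_one p K hK.1 hp3 κ hκ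
    (P2.RoadFF.splitMult_sigmaPlaces_degreeOne_of_isErratumField W p hmq hnsq hK)
  obtain ⟨hT, hCh⟩ := isTorsion_XAc_and_charIdeal_empty_mul_le_of_sigmaLocal_of_prop323 W p hp3.le K hK.1
    hHp v hv κ hκ γ (W.sigmaPlacesFinset p K) (W.forall_mem_sigmaPlacesFinset_not_mem p K) _ _ _
    (W.isEulerDataAt_of_mem_sigmaPlacesFinset p K κ) hB hloc h323 hT₀
  exact ⟨Finset.finite_toSet _, hT, W.sigmaEulerElement_ne_zero p K κ, hCh⟩

end SigmaData

/-! ### §2 The two-slot Fitting congruence frame at a ram-free datum from F4♯‡ + F3♯‡ -/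

set_option maxHeartbeats 400000 in
/-- **ROAD FF's deciding step on the RAM-FREE data: the two-slot Fitting congruence frame at every ram-free erratum datum
and every X-slot `𝔭bar ≠ 𝔭_{ι′}` from the PRINT-FAITHFUL input F4♯‡ (OPEN; (2.5) on the self-dual `A_g` under (i)
«`ρ̄_g|_{G_K}` irreducible», (iii) «some `q ∥ M` non-split in `K`») + F3♯‡ (PUB; ram-free member package) — every other
input a THEOREM of the tree.** Binders = those of `P2.IMCDivIntCoreFrameAtErratumDataBRamFree W p`; conclusion
`P2.RoadFF.FittingCongruenceFrameTwoSlotAt W p κ 𝔭_{ι′} 𝔭bar γ ι′ Dt.f Σ P_Σ`. Assembly = imc-p1 g30's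
`…_of_thm23SelfDualIrrK_OPEN_of_framesNonsplitWt` symbol for symbol, except: (i) at each Hida member from the BINDER `Surj W p`
(`SurjIrrK.isSimpleOrder_subrepresentation_residualRep_comp_of_surj`), F3♯‡ called without the witness, its conclusion
destructured without the two footnote-1 conjuncts. CONDITIONAL on `h23` (OPEN) and `hL` (published); closes nothing by itself.
[cite: Castella2018Erratum, §2 (p. 2), Thm. 1.1 (iii), Thm. 2.3 (i) and (iii) with footnote 1, (2.5) and proof of Thm. 1.1 (p. 4)]
[cite: FouquetWan2021, Thm. 4.41 (hypotheses as printed)] [cite: Serre1972, §2.4 Prop. 15] -/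
theorem P2.RoadFF.fittingCongruenceFrameTwoSlotAt_of_thm23SelfDualIrrK_OPEN_of_framesWtRamFree
    (h23 : erratumThm23_charIdeal_sigma_le_of_isTorsion_selfDual_irrK_OPEN)
    (hL : erratum_exists_frames_members_sigma_congruence_wt_ramFree)
    (W : WeierstrassCurve ℚ) [W.IsElliptic] [W.IsGloballyMinimal] (p : ℕ) [Fact p.Prime] :
    ∀ [NeZero (W.conductorNorm ℤ)] (q : ℕ) [Fact q.Prime] (K : Type) [Field K] [NumberField K]
      (Dt : ModularParametrizationData W (W.conductorNorm ℤ))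
      (H : HeegnerDatum (W.conductorNorm ℤ) (NumberField.discr K)) (w₀ : InfinitePlace K)
      (P : (W.baseChange K).toAffine.Point), 5 ≤ p → Mult W p → Surj W p →
      (∀ P₀ : (W.baseChange ℚ_[p]).toAffine.Point, p • P₀ = 0 → P₀ = 0) → W.analyticRank = 1 →
      q ≠ p → Mult W q → ¬ W.HasSplitMultiplicativeReductionAtPrime q → IsErratumField W K q →
      Cas20Standing K p (W.conductorNorm ℤ / p) →
      WeierstrassCurve.Affine.Point.map w₀.embedding.toRatAlgHom P = heegnerPointComplex Dt H →
      ¬ (p : ℤ) ∣ Dt.c → ¬ IsOfFinAddOrder P →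
      ∀ (κ : ZpExtension K p), κ.IsAnticyclotomic →
        ∀ (γ : Field.absoluteGaloisGroup K) [Fact (κ.IsTopGenerator γ)] (ι' : PadicAlgCl p ≃+* ℂ)
          (e : K →+* ℚ_[p]),
          (∀ k : 𝓞 K, k ∈ (primeOfEmbeddingDatum p ι' w₀.embedding).asIdeal ↔ ‖e (k : K)‖ < 1) →
          ∀ (𝔭bar : HeightOneSpectrum (𝓞 K)), ((p : ℕ) : 𝓞 K) ∈ 𝔭bar.asIdeal →
            𝔭bar ≠ primeOfEmbeddingDatum p ι' w₀.embedding →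
            P2.RoadFF.FittingCongruenceFrameTwoSlotAt W p κ (primeOfEmbeddingDatum p ι' w₀.embedding) 𝔭bar γ ι'
              Dt.f (↑(W.sigmaPlacesFinset p K) : Set (HeightOneSpectrum (𝓞 K))) (W.sigmaEulerElement p K κ) := by
  intro _ q _ K _ _ Dt H w₀ P hp5 hmult hsurj htors hr hqp hmq hns hK hCas hP hc hinf κ hκ γ _ ι' e he 𝔭bar h𝔭bar hne
  show P2.RoadFF.FittingCongruenceFrameTwoSlotAt W p κ (primeOfEmbeddingDatum p ι' w₀.embedding) 𝔭bar γ ι'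
    Dt.f (↑(W.sigmaPlacesFinset p K) : Set (HeightOneSpectrum (𝓞 K))) (W.sigmaEulerElement p K κ)
  -- ### the datum's elementary consequences (as in g11's `_of_weak_facts`)
  have hp3 : 3 < p := lt_of_lt_of_le (by norm_num) hp5
  have hirr : Irr W p := hasIrreducibleModPGaloisRep_of_hasSurjectiveModNGaloisRep W p hsurj
  have hpN : p ∣ W.conductorNorm ℤ := dvd_conductorNorm_of_mult hmult
  have hsplit2 : ((Ideal.span {(p : ℤ)}).primesOver (𝓞 K)).ncard = 2 :=
    hK.ncard_primesOver_eq_two Fact.out hpN hqp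
  have hsp : SplitsIn K p := hK.splitsIn_of_mult hmult (Ne.symm hqp)
  have hHp : SatisfiesHeegnerHypothesis p K := satisfiesHeegnerHypothesis_of_splitsIn Fact.out hsp
  have hHeeg : ∃ β : ℤ, (4 * (W.conductorNorm ℤ) : ℤ) ∣ β ^ 2 - NumberField.discr K :=
    ⟨H.β, H.dvd_sq_sub⟩
  have hnq : ((Ideal.span {(q : ℤ)}).primesOver (𝓞 K)).ncard ≠ 2 :=
    ncard_primesOver_ne_two_of_dvd_discr hK.1.1 Fact.out hK.2.1
  have key : ∀ (ℓ : ℕ) [Fact ℓ.Prime], Mult W ℓ →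
      ((Ideal.span {(ℓ : ℤ)}).primesOver (𝓞 K)).ncard ≠ 2 → ℓ = q := by
    intro ℓ _ hℓ hnsℓ
    by_contra hne'
    exact hnsℓ (hK.2.2.1 ℓ Fact.out (dvd_conductorNorm_of_mult hℓ) hne')
  -- the erratum's print hypothesis (iii), first half, at this datum: `q` is the only non-`K`-split multiplicative prime, `E` nonsplit at `q`
  have hiii0 : ∀ (ℓ : ℕ) [Fact ℓ.Prime], Mult W ℓ → ((Ideal.span {(ℓ : ℤ)}).primesOver (𝓞 K)).ncard ≠ 2 →
      ¬ W.HasSplitMultiplicativeReductionAtPrime ℓ :=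
    erratum_hypothesis_iii_of_forall_eq W K key hns
  have hMpos : 0 < W.conductorNorm ℤ / p := hCas.2.2.2.2.2.1
  have hpM : ¬ p ∣ W.conductorNorm ℤ / p := hCas.2.2.2.2.2.2.1
  have hq2 : q ≠ 2 := by
    rintro rfl
    have hodd : Odd (NumberField.discr K) := hCas.2.1
    have h2d : (2 : ℤ) ∣ NumberField.discr K := by exact_mod_cast hK.2.1
    exact (Int.not_even_iff_odd.mpr hodd) (even_iff_two_dvd.mpr h2d)
  have hqprime : q.Prime := Fact.out
  have hqN : q ∣ W.conductorNorm ℤ := dvd_conductorNorm_of_mult hmq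
  have hqM : q ∣ W.conductorNorm ℤ / p := by
    have hqN' := hqN
    rw [← Nat.div_mul_cancel hpN] at hqN'
    exact ((Nat.Coprime.dvd_mul_right ((Nat.coprime_primes hqprime Fact.out).2 hqp)).1 hqN')
  have hM : 3 ≤ W.conductorNorm ℤ / p := by
    have hq3 : 3 ≤ q := by
      rcases hqprime.eq_two_or_odd' with h | h
      · exact absurd h hq2
      · have := hqprime.two_le; omega
    exact hq3.trans (Nat.le_of_dvd hMpos hqM)
  haveI : NeZero (W.conductorNorm ℤ / p) := ⟨hMpos.ne'⟩
  -- ### `Σ`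
  have hSfin : (↑(W.sigmaPlacesFinset p K) : Set (HeightOneSpectrum (𝓞 K))).Finite :=
    (W.sigmaPlacesFinset p K).finite_toSet
  have hSp : ∀ w ∈ (↑(W.sigmaPlacesFinset p K) : Set (HeightOneSpectrum (𝓞 K))),
      ((p : ℕ) : 𝓞 K) ∉ w.asIdeal :=
    fun w hw => W.forall_mem_sigmaPlacesFinset_not_mem p K w (Finset.mem_coe.1 hw)
  have hS : ∀ w : HeightOneSpectrum (𝓞 K), w ∉ (↑(W.sigmaPlacesFinset p K) : Set (HeightOneSpectrum (𝓞 K))) →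
      ((p : ℕ) : 𝓞 K) ∉ w.asIdeal → (W.baseChange K).HasGoodReductionAt w := by
    intro w hw hwp
    rw [WeierstrassCurve.coe_sigmaPlacesFinset] at hw
    exact WeierstrassCurve.hasGoodReductionAt_baseChange_of_not_mem_sigmaPlaces hw hwp
  have hSM : ∀ w : HeightOneSpectrum (𝓞 K), w ∉ (↑(W.sigmaPlacesFinset p K) : Set (HeightOneSpectrum (𝓞 K))) →
      ((W.conductorNorm ℤ / p : ℕ) : 𝓞 K) ∉ w.asIdeal := by
    intro w hw hM'
    rw [WeierstrassCurve.coe_sigmaPlacesFinset] at hw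
    exact hw (WeierstrassCurve.mem_sigmaPlaces_of_tameLevel_mem hpN hpM hM')
  -- ### `K_{𝔭bar} → ℚ_p` (degree one)
  obtain ⟨heb, hfb⟩ := degreeOne_of_splitsIn hK.1.1 hsp h𝔭bar
  obtain ⟨φ⟩ := AcSelmer.exists_ringHom_adicCompletion_padic_of_degreeOne p 𝔭bar h𝔭bar heb hfb
  -- ### F3♯‡ (ram-free member package): frames + members (weight progression), receptacle maps `a = unrToCpInt`, `j = toUnr` — (iii) first half = `hiii0`; NO witness
  obtain ⟨ΩK, Ωp, L, hΩ, hLf, hmem⟩ :=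
    hL ι' W K (primeOfEmbeddingDatum p ι' w₀.embedding) κ γ Dt.isNewformOf rfl hp3 hmult hM hirr hiii0
      hK.1 hCas.2.1 hHeeg hsplit2 (natCast_mem_primeOfEmbeddingDatum p ι' w₀.embedding)
      (forall_mem_primeOfEmbeddingDatum_iff p ι' hK.1 w₀) hκ (R1.unrToCpInt p) (toUnr p)
      (R1.coe_unrToCpInt p) (coe_toUnr p)
  choose Dm Qm hDm using fun m : ℕ => hmem (max m 1) (le_max_right m 1)
  -- the inclusions `b_m : 𝒪_m → 𝓞_{ℂ_p}` (characterised) and their coefficient squares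
  choose b hb using fun m : ℕ => exists_ringHom_padicCoeffIntegers_padicComplexInt (Dm m).ι
  -- ### topologies and coefficient-ring instances (as in g11)
  letI : TopologicalSpace (IwasawaAlgebra p) := ⊥
  haveI : DiscreteTopology (IwasawaAlgebra p) := ⟨rfl⟩
  letI τ : ∀ m : ℕ, TopologicalSpace (PowerSeries (padicCoeffIntegers (Dm m).ι)) := fun _ => ⊥
  haveI : ∀ m : ℕ, DiscreteTopology (PowerSeries (padicCoeffIntegers (Dm m).ι)) := fun _ => ⟨rfl⟩
  haveI : ∀ m : ℕ, IsPrincipalIdealRing (padicCoeffIntegers (Dm m).ι) := fun m =>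
    (Dm m).isPrincipalIdealRing_coeffRing
  haveI : ∀ m : ℕ, Module.Free ℤ_[p] (padicCoeffIntegers (Dm m).ι) := fun m => (Dm m).moduleFree_coeffRing
  haveI : ∀ m : ℕ, Module.Finite ℤ_[p] (padicCoeffIntegers (Dm m).ι) := fun m =>
    (Dm m).moduleFinite_coeffRing
  -- finite generation of `X^Σ_ac(A_{g_m})` over `Λ_{𝒪_m}` (SU14 L.3.1.9 is a theorem; T6 + T7 + T8a)
  haveI : ∀ m : ℕ, Module.Finite (PowerSeries (padicCoeffIntegers (Dm m).ι))
      (XBig κ ((Dm m).Δ.selfDualCofreeRepOver K) 𝔭bar (↑(W.sigmaPlacesFinset p K) : Set (HeightOneSpectrum (𝓞 K)))) :=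
    fun m =>
      haveI := (Dm m).finiteDimensional_padicCoeffField
      SkinnerUrban2014.moduleFinite_XBig_of_lemma319 SkinnerUrban2014.lemma319_finite_XBig_holds κ 𝔭bar _ hSfin
        ((Dm m).Δ.selfDualCofreeRepOver K)
        (GreenbergSelmer.Cofree.exists_pow_psmul_eq_zero (Dm m).ι (Dm m).Δ.selfDualRep)
        (GreenbergSelmer.Cofree.divisible (padicCoeffField (Dm m).ι) (Dm m).Δ.selfDualRep (Fact.out : p.Prime).ne_zero)
        (GreenbergSelmer.Cofree.finite_setOf_psmul_eq_zero (Dm m).ι (Dm m).Δ.selfDualRep)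
        (SelfDualTwist.selfDualCofreeRepOver_localMap_inr_apply_eq_self (Dm m).Δ K _ hSM)
  -- ### the member congruences `e_m` (F1 + SelBC + Frob + (b) + Lemma 2.1 — all theorems)
  have hEm : ∀ m : ℕ, 1 ≤ m →
      Nonempty ((((PowerSeries (padicCoeffIntegers (Dm m).ι)) ⊗[IwasawaAlgebra p]
            AcSelmer.XAc (W.baseChange K) p κ 𝔭bar (↑(W.sigmaPlacesFinset p K) : Set (HeightOneSpectrum (𝓞 K))) γ) ⧸
          (((Ideal.span {(C (p : ℤ_[p]) : IwasawaAlgebra p)}).map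
              (algebraMap (IwasawaAlgebra p) (PowerSeries (padicCoeffIntegers (Dm m).ι)))) ^ m •
            (⊤ : Submodule (PowerSeries (padicCoeffIntegers (Dm m).ι))
              ((PowerSeries (padicCoeffIntegers (Dm m).ι)) ⊗[IwasawaAlgebra p]
                AcSelmer.XAc (W.baseChange K) p κ 𝔭bar (↑(W.sigmaPlacesFinset p K) : Set (HeightOneSpectrum (𝓞 K))) γ))))
          ≃ₗ[PowerSeries (padicCoeffIntegers (Dm m).ι)]
        (XBig κ ((Dm m).Δ.selfDualCofreeRepOver K) 𝔭bar (↑(W.sigmaPlacesFinset p K) : Set (HeightOneSpectrum (𝓞 K))) ⧸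
          (((Ideal.span {(C (p : ℤ_[p]) : IwasawaAlgebra p)}).map
              (algebraMap (IwasawaAlgebra p) (PowerSeries (padicCoeffIntegers (Dm m).ι)))) ^ m •
            (⊤ : Submodule (PowerSeries (padicCoeffIntegers (Dm m).ι))
              (XBig κ ((Dm m).Δ.selfDualCofreeRepOver K) 𝔭bar (↑(W.sigmaPlacesFinset p K) : Set (HeightOneSpectrum (𝓞 K)))))))) := by
    intro m hm
    exact nonempty_quotPow_congr_of_eq _ (max_eq_left hm)
      (SelfDualTwist.nonempty_memberCongruence_erratum_of_facts_selfDual SkinnerUrban2014.prop323_XAc_equiv_XBigDecomp_holds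
        selmerBig_eq_selmerBigDecomp_of_unramifiedOutside_holds
        Skinner2016.selmerBig_extendScalars_equiv_baseChange_holds hp5 hirr hK.1 hHp 𝔭bar h𝔭bar φ htors _ hSfin
        hSp hS hSM κ hκ γ (Dm m) (le_max_right m 1) (hDm m).1).some
  -- ### (2.5)_m from F4♯‡ at the member `g_m` (SELF-DUAL module; (i)/(iii) as printed), receptacle `𝓞_{ℂ_p}⟦T⟧`
  have hCh : ∀ m : ℕ, 1 ≤ m →
      Module.IsTorsion (PowerSeries (padicCoeffIntegers (Dm m).ι))
          (XBig κ ((Dm m).Δ.selfDualCofreeRepOver K) 𝔭bar (↑(W.sigmaPlacesFinset p K) : Set (HeightOneSpectrum (𝓞 K)))) →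
        (XBig.charIdeal κ ((Dm m).Δ.selfDualCofreeRepOver K) 𝔭bar (↑(W.sigmaPlacesFinset p K) : Set (HeightOneSpectrum (𝓞 K)))).map
          (PowerSeries.map (b m)) ≤ Ideal.span {Qm m} := by
    intro m _ hT
    obtain ⟨hkD, hcompD, hStD, hQ, _⟩ := hDm m
    have hk2 : 2 ≤ (Dm m).k := (Dm m).two_lt_k.le
    have hkeven : Even (Dm m).k := by
      obtain ⟨c, hc⟩ := (Dm m).dvd_k_sub_two
      have hp2 : Even ((p : ℤ) - 1) := by
        have hpodd : Odd p := (Fact.out : p.Prime).odd_of_ne_two (by omega)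
        obtain ⟨r, hr⟩ := hpodd
        exact ⟨r, by omega⟩
      have : (Dm m).k = ((p : ℤ) - 1) * c + 2 := by omega
      rw [this]
      exact (hp2.mul_right c).add (by decide)
    have h2 : ((Ideal.span {(2 : ℤ)}).primesOver (𝓞 K)).ncard ≠ 2 →
        (2 ∣ W.conductorNorm ℤ / p ∧ ¬ 4 ∣ W.conductorNorm ℤ / p) := by
      intro h2ns
      have hmult2 : Mult W 2 := by
        by_cases h2N : 2 ∣ W.conductorNorm ℤ
        · by_cases h2q : (2 : ℕ) = q
          · exact absurd h2q.symm hq2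
          · exact absurd (hK.2.2.1 2 Nat.prime_two h2N h2q) h2ns
        · exact absurd (hK.2.2.2.1 h2N) h2ns
      haveI : Fact (Nat.Prime 2) := ⟨Nat.prime_two⟩
      have hfac : (W.conductorNorm ℤ).factorization 2 = 1 :=
        WeierstrassCurve.factorization_conductorNorm_eq_one_of_hasMultiplicativeReductionAtPrime W 2 hmult2
      have hp2 : p ≠ 2 := by omega
      have hN0 : W.conductorNorm ℤ ≠ 0 := by
        intro h0; rw [h0] at hMpos; simp at hMpos
      have hfacM : (W.conductorNorm ℤ / p).factorization 2 = 1 := by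
        rw [Nat.factorization_div hpN, Finsupp.coe_tsub, Pi.sub_apply, hfac,
          Nat.Prime.factorization (Fact.out : p.Prime), Finsupp.single_apply, if_neg hp2, Nat.sub_zero]
      refine ⟨?_, fun h4 => ?_⟩
      · exact (Nat.Prime.dvd_iff_one_le_factorization Nat.prime_two hMpos.ne').mpr (by omega)
      · have := (Nat.Prime.pow_dvd_iff_le_factorization Nat.prime_two hMpos.ne').mp
          (show 2 ^ 2 ∣ W.conductorNorm ℤ / p by simpa using h4)
        omega
    have hiii : ∀ ℓ : ℕ, ℓ.Prime → ℓ ∣ W.conductorNorm ℤ / p →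
        ((Ideal.span {(ℓ : ℤ)}).primesOver (𝓞 K)).ncard ≠ 2 →
          ¬ ℓ ^ 2 ∣ W.conductorNorm ℤ / p ∧
            (UpperHalfPlane.qExpansion 1 ⇑(Dm m).g).coeff ℓ = -((ℓ : ℂ) ^ ((Dm m).k / 2 - 1).toNat) := by
      intro ℓ hℓ hℓM hℓns
      refine ⟨fun hsq => ?_, hStD ℓ hℓ hℓM hℓns⟩
      have hℓN : ℓ ∣ W.conductorNorm ℤ := hℓM.trans (Nat.div_dvd_of_dvd hpN)
      -- `ℓ` non-split and dividing `N` is `q` (Heegner field: every other prime factor splits), and `q ∥ N`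
      have hℓq : ℓ = q := by
        by_contra hne'
        exact hℓns (hK.2.2.1 ℓ hℓ hℓN hne')
      subst hℓq
      have hfac : (W.conductorNorm ℤ).factorization ℓ = 1 :=
        WeierstrassCurve.factorization_conductorNorm_eq_one_of_hasMultiplicativeReductionAtPrime W ℓ hmq
      have h2le := (Nat.Prime.pow_dvd_iff_le_factorization hℓ (by
        intro h0; rw [h0] at hMpos; simp at hMpos)).mp (hsq.trans (Nat.div_dvd_of_dvd hpN))
      omega
    have hHeegM : ∃ β : ℤ, (4 * (W.conductorNorm ℤ / p : ℕ) : ℤ) ∣ β ^ 2 - NumberField.discr K := by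
      obtain ⟨β, hβ⟩ := hHeeg
      refine ⟨β, (dvd_trans ?_ hβ)⟩
      exact mul_dvd_mul_left 4 (Int.natCast_dvd_natCast.mpr (Nat.div_dvd_of_dvd hpN))
    -- (i) AS PRINTED at the member `g_m`: `ρ̄_{g_m}|_{G_K}` irreducible, from the BINDER `Surj W p` (imc-p1 g27's bridge) —
    -- on the ram-free data `Surj` comes from ANY `E[p]`-ramified multiplicative prime, not from the datum's `q`
    have hirrK : IsSimpleOrder (Subrepresentation ((SkinnerUrban2014.residualRep (Dm m).Δ).comp
        (absGaloisRestrict ℚ K : absoluteGaloisGroup K →* absoluteGaloisGroup ℚ))) :=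
      SurjIrrK.isSimpleOrder_subrepresentation_residualRep_comp_of_surj (by omega)
        hsurj (Dm m) (le_max_right m 1) K hK.1.1
    -- (iii) AS PRINTED: the datum's `q` is a prime with `q ∥ M` non-split in `K`
    have hiii' : ∃ q₀ : ℕ, q₀.Prime ∧ q₀ ∣ W.conductorNorm ℤ / p ∧ ¬ q₀ ^ 2 ∣ W.conductorNorm ℤ / p ∧
        ((Ideal.span {(q₀ : ℤ)}).primesOver (𝓞 K)).ncard ≠ 2 :=
      ⟨q, hqprime, hqM, (hiii q hqprime hqM hnq).1, hnq⟩
    have hSp' : ∀ w ∈ W.sigmaPlacesFinset p K, ((p : ℕ) : 𝓞 K) ∉ w.asIdeal :=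
      fun w hw => W.forall_mem_sigmaPlacesFinset_not_mem p K w hw
    have hSM' : ∀ w : HeightOneSpectrum (𝓞 K), ((W.conductorNorm ℤ / p : ℕ) : 𝓞 K) ∈ w.asIdeal →
        w ∈ W.sigmaPlacesFinset p K := by
      intro w hw
      by_contra hw'
      exact hSM w (by rwa [Finset.mem_coe]) hw
    exact h23 ι' (Dm m).g (Dm m).ι (Dm m).Δ K (primeOfEmbeddingDatum p ι' w₀.embedding) 𝔭bar κ γ
      (W.sigmaPlacesFinset p K) (Dm m).isNewform hk2 hkeven hM hpM hp3 hcompD (Dm m).norm_coeff_p hK.1 hHeegM hsplit2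
      (natCast_mem_primeOfEmbeddingDatum p ι' w₀.embedding) (forall_mem_primeOfEmbeddingDatum_iff p ι' hK.1 w₀)
      h𝔭bar hne hirrK hiii' h2 hiii hκ hSp' hSM' (b m) (hb m) ΩK
      ⟨R1.unrToCpInt p (Ωp : unrIntegers p), R1.unrToCpInt p ((Ωp⁻¹ : (unrIntegers p)ˣ) : unrIntegers p),
        by rw [← map_mul, Units.mul_inv, map_one], by rw [← map_mul, Units.inv_mul, map_one]⟩
      (Qm m) hΩ hQ hT
  -- ### (c), one-sided, from F3♯-nonsplit's congruence
  have hc' : ∀ m : ℕ, 1 ≤ m →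
      Ideal.span {Qm m} ≤
        Ideal.span {PowerSeries.map (R1.unrToCpInt p) (L * PowerSeries.map (toUnr p) (W.sigmaEulerElement p K κ))} ⊔
          Ideal.span {(PowerSeries.C (((p : ℕ) : 𝓞_ℂ_[p]) ^ m) : PowerSeries 𝓞_ℂ_[p])} := by
    intro m hm
    obtain ⟨_, _, _, _, hcong⟩ := hDm m
    rw [max_eq_left hm] at hcong
    exact le_sup_left.trans hcong.le
  -- ### feed the two-slot Fitting congruence frame through the `𝓞_{ℂ_p}` receptacle
  exact P2.RoadFF.fittingCongruenceFrameTwoSlotAt_of_members_descent_le_cpInt_printed hΩ hLf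
    (L * PowerSeries.map (toUnr p) (W.sigmaEulerElement p K κ)) (dvd_refl _) hSfin
    (fun m => PowerSeries (padicCoeffIntegers (Dm m).ι))
    (fun m => PowerSeries.map (b m))
    (fun m => map_comp_algebraMap_eq_of_coe_eq (b m) (hb m))
    (fun m => XBig κ ((Dm m).Δ.selfDualCofreeRepOver K) 𝔭bar (↑(W.sigmaPlacesFinset p K) : Set (HeightOneSpectrum (𝓞 K))))
    Qm (fun m hm => (hEm m hm).some) hCh hc'

/-! ### §3 The ram-free re-oriented core shape of every pair -/

/-- **ROAD FF DELIVERS THE RAM-FREE RE-ORIENTED CORE SHAPE `P2.IMCDivIntCoreFrameAtErratumDataBRamFree W p` OF EVERY PAIR**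
from F4♯‡ (OPEN) + F3♯‡ + the LOCAL fact (K2 item 20495, proved) + Shapiro (SU14 Prop. 3.2.3, proved on the tree:
feed `SkinnerUrban2014.prop323_XAc_equiv_XBigDecomp_holds`) + GZK + modularity + the two Poitou–Tate facts: at each ram-free
datum and X-slot `𝔭bar`, §1's Σ-data at `𝔭bar` and §2's two-slot Fitting congruence frame, recombined by imc24b's datum glue
`P2.exists_intCoreFrame_of_roadFF_fitting_twoSlot` (torsion bounds, `Σ`-removal, two-prime cancellation in `R₀⟦T⟧`, last
mile to `𝓞_{ℂ_p}⟦T⟧`). This is the `h3` input of `KernelFromPrintBRamFree.rest3NoWitnessBranchAtFive_of_print_of_coreBRamFree_of_noOddNonsplit`.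
CONDITIONAL on the named facts; nothing booked. [cite: Castella2018Erratum, (2.4)–(2.5) and proof of Thm. 1.1 (p. 4), read one-sidedly]
[cite: FouquetWan2021, Thm. 4.41] [cite: JetchevSkinnerWan2017, proof of Thm. 6.1.6 and Thm. 3.3.1] [cite: SkinnerUrban2014, Prop. 3.2.3] -/
theorem P2.imcDivIntCoreFrameAtErratumDataBRamFree_of_thm23SelfDualIrrK_OPEN_of_framesWtRamFree_of_facts
    (h23 : erratumThm23_charIdeal_sigma_le_of_isTorsion_selfDual_irrK_OPEN)
    (hL : erratum_exists_frames_members_sigma_congruence_wt_ramFree)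
    (hloc : sigmaLocal_charIdeal_eulerFactor_mem_of_noTamagawaDefect)
    (h323 : SkinnerUrban2014.prop323_XAc_equiv_XBigDecomp)
    (hGZK : rank_eq_analyticRank_of_analyticRank_le_one) (hnf : exists_isNewformOf)
    (hPT : ∀ (K : Type) [Field K] [NumberField K], poitouTate_selmerStructure_duality K)
    (hPT2 : ∀ (K : Type) [Field K] [NumberField K], poitouTate_sha_tateDual K)
    (W : WeierstrassCurve ℚ) [W.IsElliptic] [W.IsGloballyMinimal] (p : ℕ) [Fact p.Prime] :
    P2.IMCDivIntCoreFrameAtErratumDataBRamFree W p := by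
  intro _ q _ K _ _ Dt H w₀ P hp5 hmult hsurj htors hr hqp hmq hns hK hCas hP hc hinf κ hκ γ _ ι' e he 𝔭bar h𝔭bar hne
  exact P2.exists_intCoreFrame_of_roadFF_fitting_twoSlot
    (P2.RoadFF.sigmaDataAt_of_sigmaLocal_of_prop323_of_facts_of_isErratumField_ramFree W p hloc h323 hGZK hnf hPT hPT2
      hp5 hmult hr hqp hmq hns hK P hinf κ hκ γ 𝔭bar h𝔭bar)
    (P2.RoadFF.fittingCongruenceFrameTwoSlotAt_of_thm23SelfDualIrrK_OPEN_of_framesWtRamFree h23 hL W p q K Dt H w₀ P hp5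
      hmult hsurj htors hr hqp hmq hns hK hCas hP hc hinf κ hκ γ ι' e he 𝔭bar h𝔭bar hne)

end Summit.BirchSwinnertonDyer.Rank1Residual.X11b

end
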